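import Summits.ValiantsHypothesis.ValiantsHypothesis.Theorems.LacunarySymmetroidMatrixDescartesDoorA26WallBubblingValueAnatomy

/-!
# Wall bubbling for `DoorA26` — NO-MIXED ANATOMY: at every point without a mixed value relation the blow-up pattern's MERGED Gram matrix vanishes

LINE / STUBS.  Crux `Theses.LacunarySymmetroid.DoorA26` (stmt-ValiantsHypothesis-19979; OPEN, typed, never asserted), line
`Cruxes/DoorA26/Lines/wall_bubbling.lean` (val-idea-15).  Target served: `Stmt.weylFaces_wall` of the line lead's statement file
`Cruxes/DoorA26/Lines/wall_bubbling_ConfluentDoor.lean` (rev 3) — (W) at points where a WEYL coincidence `δᵢ = δⱼ` meets a DISJOINT-type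
value wall and no mixed relation («(D)-type with merged letters; W1/W3 instruments») — and, as special cases, W2's VALUE-GENERIC ANATOMY
(`…WallBubblingValueAnatomy.valueAnatomy`, p649136) and the (D) certificate (`…WallBubblingPureDSieve.pureDSieve`, p610269).

THEOREM `noMixedAnatomy` (def-free; hypotheses literal as in `valueAnatomy`).  Let `δ : Fin 6 → ℝ` satisfy the single hypothesis

  NO MIXED VALUE RELATION: `2·δ i = δ k + δ l ⟹ δ k = δ l` (all letters `i, k, l`)

— Weyl coincidences `δ a = δ b` AND disjoint-type value relations `δ a + δ b = δ c + δ d` (four distinct values) are ALLOWED; it holds at every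
value-generic point (W2 #4's hypothesis) and at every injective `δ` without a mixed coincidence ((D)'s hypothesis), and it is exactly the
hypothesis `¬ HasMixedCoincidence` of `Stmt.weylFaces_wall` read on values.  Then every realisable blow-up pattern `G` (`BlockSumsZero δ G`,
`G = ε·polar(S ·, S ·)`, literal) has ALL MERGED GRAM ENTRIES ZERO: the letter value-class sums `Σ_{δ b = δ a} S b` are `det`-null and pairwise
`det`-orthogonal, hence (tree lemma `exists_smul_of_polar_eq_zero`) all on ONE null ray — verbatim the conclusion of `valueAnatomy`.
So at a Weyl ∩ disjoint-wall point the first-order anatomy is the SAME as at a value-generic Weyl point: the disjoint relation adds no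
first-order pattern (and, for the successor: it REMOVES one slot from the third-level confluent object, 21 → 20, so the extended count there
is `≤ 19` without any door — the reason `Stmt.weylFaces_wall` was split off; that exit is not in this file).

MECHANISM (`mergedGram_blockSums`, `noMixed_perturb_*`, `noMixedAnatomy`).  Choose the least letter `rep a` of each value class; move every
non-representative letter to a huge generic exponent (`M·4^(a+1)`, `M = 1 + Σ|δ|`) and give it the zero letter, and give each representative the
CLASS SUM `Σ_{δ b = δ a} S b`: the new exponent vector is injective with no mixed coincidence (elementary size comparison), the new polar Gram
matrix is realisable, and its block sums are the MERGED block sums of `G` (bilinearity `polar_sum_sum` + regrouping by classes), hence zero.  The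
tree's `pureDSieve` then kills the merged Gram matrix.  Elementary; no new definitions; nothing here bears on (W)/(M)/(R) themselves, on
`DoorA26`, on `MatrixDescartes` (stmt-ValiantsHypothesis-18050) or on `VP ≠ VNP`; registers unchanged.

Cell `pub-symmetroid`, seat val-sym-door-p2 g12 (W1; `Stmt.weylFaces_wall` entrance), `--supports stmt-ValiantsHypothesis-19979 --as helper`.
[folklore] bilinearity of the polar form + the cell's (D) sieve. [this work] the merging device.
-/

-- `Summit.ValiantsHypothesis.ValiantsHypothesis.…` repeats a component by the D-0017 layout
-- (single-conjunct summit), which the `dupNamespace` linter flags; the name is mandated.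
set_option linter.dupNamespace false

namespace Summit.ValiantsHypothesis.ValiantsHypothesis.Theorems.LacunarySymmetroidMatrixDescartes.WallBubbling

open Finset Matrix
open scoped BigOperators

/-! ## §1 Size comparison: a huge exponent takes part in no mixed relation -/

/-- If `|x|, |z| ≤ W` and `y ≥ 4W > 0` then `y` is in no mixed relation with `x, z` in any role. [folklore] -/
theorem noMixed_of_big {x y z W : ℝ} (hW : 0 < W) (hx : |x| ≤ W) (hz : |z| ≤ W) (hy : 4 * W ≤ y) :
    2 * x ≠ y + z ∧ 2 * y ≠ x + z ∧ 2 * z ≠ x + y := by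
  have hx' := abs_le.mp hx
  have hz' := abs_le.mp hz
  refine ⟨?_, ?_, ?_⟩ <;> intro h <;> linarith [hx'.1, hx'.2, hz'.1, hz'.2]

/-! ## §2 The anatomy -/

/-- **NO-MIXED ANATOMY.**  At an exponent vector with no mixed VALUE relation (`2δᵢ = δₖ + δₗ ⟹ δₖ = δₗ`; Weyl coincidences and disjoint-type
value walls allowed), a realisable blow-up pattern has every letter value-class sum `Σ_{δ b = δ a} S b` `det`-null, the class sums pairwise
`det`-orthogonal, hence all on ONE null ray (same conclusion as `valueAnatomy`, weaker hypothesis). [this work] -/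
theorem noMixedAnatomy (δ : Fin 6 → ℝ) (hNM : ∀ i k l : Fin 6, 2 * δ i = δ k + δ l → δ k = δ l)
    (G : Matrix (Fin 6) (Fin 6) ℝ)
    (hB : ∀ v : ℝ, (∑ a, ∑ b, if δ a + δ b = v then G a b else 0) = 0)
    (ε : ℝ) (S : Fin 6 → Matrix (Fin 2) (Fin 2) ℝ) (hε : ε = 1 ∨ ε = -1) (hS : ∀ l, (S l).IsSymm)
    (hG : ∀ p q, G p q = ε * (((S p + S q).det - (S p).det - (S q).det) / 2)) :
    (∀ a : Fin 6, (∑ b ∈ Finset.univ.filter (fun b => δ b = δ a), S b).det = 0) ∧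
    (∀ a c : Fin 6,
      (((∑ b ∈ Finset.univ.filter (fun b => δ b = δ a), S b) + (∑ b ∈ Finset.univ.filter (fun b => δ b = δ c), S b)).det
        - (∑ b ∈ Finset.univ.filter (fun b => δ b = δ a), S b).det
        - (∑ b ∈ Finset.univ.filter (fun b => δ b = δ c), S b).det) / 2 = 0) ∧
    (∀ a c : Fin 6, (∑ b ∈ Finset.univ.filter (fun b => δ b = δ a), S b) ≠ 0 →
      ∃ r : ℝ, (∑ b ∈ Finset.univ.filter (fun b => δ b = δ c), S b) = r • (∑ b ∈ Finset.univ.filter (fun b => δ b = δ a), S b)) := by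
  classical
  have hε0 : ε ≠ 0 := by rcases hε with rfl | rfl <;> norm_num
  -- letter classes and their least representatives
  set cl : Fin 6 → Finset (Fin 6) := fun a => Finset.univ.filter (fun b => δ b = δ a) with hcl
  have mem_cl : ∀ a b, b ∈ cl a ↔ δ b = δ a := fun a b => by simp [hcl]
  have cl_ne : ∀ a, (cl a).Nonempty := fun a => ⟨a, (mem_cl a a).mpr rfl⟩
  let rep : Fin 6 → Fin 6 := fun a => (cl a).min' (cl_ne a)
  have rep_val : ∀ a, δ (rep a) = δ a := fun a => (mem_cl a _).mp (Finset.min'_mem _ (cl_ne a))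
  have cl_eq : ∀ a b, δ a = δ b → cl a = cl b := fun a b h => by
    ext x; rw [mem_cl, mem_cl, h]
  have rep_eq : ∀ a b, δ a = δ b → rep a = rep b := by
    intro a b h
    simp only [rep]
    congr 1
    exact cl_eq a b h
  have rep_rep : ∀ a, rep (rep a) = rep a := fun a => rep_eq _ _ (rep_val a)
  have rep_inj : ∀ a b, rep a = a → rep b = b → δ a = δ b → a = b := by
    intro a b ha hb h
    rw [← ha, ← hb]; exact rep_eq a b h
  -- class sums
  set T : Fin 6 → Matrix (Fin 2) (Fin 2) ℝ := fun a => ∑ b ∈ cl a, S b with hT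
  have T_eq : ∀ a, T (rep a) = T a := fun a => by simp only [hT, cl_eq _ _ (rep_val a)]
  have T_symm : ∀ a, (T a).IsSymm := fun a => by
    unfold Matrix.IsSymm; simp only [hT]; rw [Matrix.transpose_sum]; exact Finset.sum_congr rfl fun b _ => (hS b).eq
  -- the perturbed system: representatives keep their exponent and carry the class sum; the others go far away with the zero letter
  set M : ℝ := 1 + ∑ b, |δ b| with hM
  have hMpos : 0 < M := by
    have : 0 ≤ ∑ b, |δ b| := Finset.sum_nonneg fun b _ => abs_nonneg _
    linarith
  have hδM : ∀ a, |δ a| ≤ M := fun a => by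
    have : |δ a| ≤ ∑ b, |δ b| := Finset.single_le_sum (f := fun b => |δ b|) (fun b _ => abs_nonneg _) (Finset.mem_univ a)
    linarith
  let y : Fin 6 → ℝ := fun a => M * 4 ^ ((a : ℕ) + 1)
  have hy4M : ∀ a, 4 * M ≤ y a := fun a => by
    show 4 * M ≤ M * 4 ^ ((a : ℕ) + 1)
    have : (4 : ℝ) ≤ 4 ^ ((a : ℕ) + 1) := by
      calc (4 : ℝ) = 4 ^ 1 := by norm_num
        _ ≤ 4 ^ ((a : ℕ) + 1) := pow_le_pow_right₀ (by norm_num) (by omega)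
    nlinarith
  have hypos : ∀ a, 0 < y a := fun a => by have := hy4M a; linarith
  have hymono : ∀ a b : Fin 6, a < b → 4 * y a ≤ y b := by
    intro a b hab
    show 4 * (M * 4 ^ ((a : ℕ) + 1)) ≤ M * 4 ^ ((b : ℕ) + 1)
    have hab' : (a : ℕ) + 2 ≤ (b : ℕ) + 1 := by have := Fin.lt_def.mp hab; omega
    have : (4 : ℝ) ^ ((a : ℕ) + 2) ≤ 4 ^ ((b : ℕ) + 1) := pow_le_pow_right₀ (by norm_num) hab'
    have e : (4 : ℝ) * (M * 4 ^ ((a : ℕ) + 1)) = M * 4 ^ ((a : ℕ) + 2) := by ring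
    rw [e]
    exact mul_le_mul_of_nonneg_left this hMpos.le
  let δ' : Fin 6 → ℝ := fun a => if rep a = a then δ a else y a
  let S' : Fin 6 → Matrix (Fin 2) (Fin 2) ℝ := fun a => if rep a = a then T a else 0
  have δ'_rep : ∀ a, rep a = a → δ' a = δ a := fun a h => by simp [δ', h]
  have δ'_non : ∀ a, rep a ≠ a → δ' a = y a := fun a h => by simp [δ', h]
  have S'_rep : ∀ a, rep a = a → S' a = T a := fun a h => by simp [S', h]
  have S'_non : ∀ a, rep a ≠ a → S' a = 0 := fun a h => by simp [S', h]
  -- size facts: representatives are small, the others are huge and well separated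
  have small : ∀ a, rep a = a → |δ' a| ≤ M := fun a h => by rw [δ'_rep a h]; exact hδM a
  have big_vs_small : ∀ a b, rep a = a → rep b ≠ b → |δ' a| ≤ y b / 4 ∧ δ' b = y b := fun a b ha hb => by
    refine ⟨?_, δ'_non b hb⟩
    have := small a ha; have := hy4M b
    linarith
  have big_vs_big : ∀ a b, rep a ≠ a → rep b ≠ b → a < b → |δ' a| ≤ y b / 4 := fun a b ha hb hab => by
    rw [δ'_non a ha, abs_of_pos (hypos a)]
    have := hymono a b hab
    linarith
  -- (i) injectivity of δ'
  have hinj : Function.Injective δ' := by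
    intro a b h
    by_cases ha : rep a = a <;> by_cases hb : rep b = b
    · rw [δ'_rep a ha, δ'_rep b hb] at h
      exact rep_inj a b ha hb h
    · exfalso
      obtain ⟨h1, h2⟩ := big_vs_small a b ha hb
      have := hypos b
      have h3 : |δ' b| ≤ y b / 4 := by rw [← h]; exact h1
      rw [h2, abs_of_pos this] at h3
      linarith
    · exfalso
      obtain ⟨h1, h2⟩ := big_vs_small b a hb ha
      have := hypos a
      have h3 : |δ' a| ≤ y a / 4 := by rw [h]; exact h1
      rw [h2, abs_of_pos this] at h3
      linarith
    · by_contra hab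
      rcases lt_or_gt_of_ne hab with hlt | hlt
      · have h1 := big_vs_big a b ha hb hlt
        rw [h, δ'_non b hb, abs_of_pos (hypos b)] at h1
        have := hypos b; linarith
      · have h1 := big_vs_big b a hb ha hlt
        rw [← h, δ'_non a ha, abs_of_pos (hypos a)] at h1
        have := hypos a; linarith
  -- (ii) no mixed coincidence for δ'
  have hmixed : ¬ ∃ i k l : Fin 6, i ≠ k ∧ i ≠ l ∧ k ≠ l ∧ 2 * δ' i = δ' k + δ' l := by
    rintro ⟨i, k, l, hik, hil, hkl, h⟩
    -- a triple with one huge member `b` dominating the other two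
    have key : ∀ a b c : Fin 6, rep b ≠ b → |δ' a| ≤ y b / 4 → |δ' c| ≤ y b / 4 →
        2 * δ' a ≠ δ' b + δ' c ∧ 2 * δ' b ≠ δ' a + δ' c ∧ 2 * δ' c ≠ δ' a + δ' b := by
      intro a b c hb ha hc
      have hyb : δ' b = y b := δ'_non b hb
      have hW : 0 < y b / 4 := by have := hypos b; linarith
      have := noMixed_of_big (x := δ' a) (y := δ' b) (z := δ' c) hW ha hc (by rw [hyb]; linarith)
      exact this
    -- bound of any other member of the triple by the largest huge member
    have dom : ∀ a b : Fin 6, a ≠ b → rep b ≠ b → (rep a = a ∨ a < b) → |δ' a| ≤ y b / 4 := by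
      intro a b hab hb h
      rcases h with ha | hlt
      · exact (big_vs_small a b ha hb).1
      · by_cases ha : rep a = a
        · exact (big_vs_small a b ha hb).1
        · exact big_vs_big a b ha hb hlt
    by_cases hi : rep i = i <;> by_cases hk : rep k = k <;> by_cases hl : rep l = l
    · -- all representatives: a genuine value relation, excluded by `hNM` + injectivity on representatives
      rw [δ'_rep i hi, δ'_rep k hk, δ'_rep l hl] at h
      exact hkl (rep_inj k l hk hl (hNM i k l h))
    · -- only `l` huge
      exact (key i l k hl (dom i l hil hl (Or.inl hi)) (dom k l hkl hl (Or.inl hk))).1 (by linarith)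
    · -- only `k` huge
      exact (key i k l hk (dom i k hik hk (Or.inl hi)) (dom l k (Ne.symm hkl) hk (Or.inl hl))).1 h
    · -- `k`, `l` huge
      rcases lt_or_gt_of_ne hkl with hlt | hlt
      · exact (key i l k hl (dom i l hil hl (Or.inl hi)) (dom k l hkl hl (Or.inr hlt))).1 (by linarith)
      · exact (key i k l hk (dom i k hik hk (Or.inl hi)) (dom l k (Ne.symm hkl) hk (Or.inr hlt))).1 h
    · -- only `i` huge
      exact (key k i l hi (dom k i (Ne.symm hik) hi (Or.inl hk)) (dom l i (Ne.symm hil) hi (Or.inl hl))).2.1 h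
    · -- `i`, `l` huge
      rcases lt_or_gt_of_ne hil with hlt | hlt
      · exact (key i l k hl (dom i l hil hl (Or.inr hlt)) (dom k l hkl hl (Or.inl hk))).1 (by linarith)
      · exact (key k i l hi (dom k i (Ne.symm hik) hi (Or.inl hk)) (dom l i (Ne.symm hil) hi (Or.inr hlt))).2.1 h
    · -- `i`, `k` huge
      rcases lt_or_gt_of_ne hik with hlt | hlt
      · exact (key i k l hk (dom i k hik hk (Or.inr hlt)) (dom l k (Ne.symm hkl) hk (Or.inl hl))).1 h
      · exact (key k i l hi (dom k i (Ne.symm hik) hi (Or.inr hlt)) (dom l i (Ne.symm hil) hi (Or.inl hl))).2.1 h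
    · -- all huge: the largest index dominates
      rcases lt_or_gt_of_ne hik with hik' | hik' <;> rcases lt_or_gt_of_ne hil with hil' | hil' <;>
        rcases lt_or_gt_of_ne hkl with hkl' | hkl'
      · exact (key i l k hl (dom i l hil hl (Or.inr hil')) (dom k l hkl hl (Or.inr hkl'))).1 (by linarith)
      · exact (key i k l hk (dom i k hik hk (Or.inr hik')) (dom l k (Ne.symm hkl) hk (Or.inr hkl'))).1 h
      · exact absurd hkl' (lt_asymm (lt_trans hil' hik'))
      · exact (key i k l hk (dom i k hik hk (Or.inr hik')) (dom l k (Ne.symm hkl) hk (Or.inr hkl'))).1 h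
      · exact (key i l k hl (dom i l hil hl (Or.inr hil')) (dom k l hkl hl (Or.inr hkl'))).1 (by linarith)
      · exact absurd hkl' (lt_asymm (lt_trans hik' hil'))
      · exact (key k i l hi (dom k i (Ne.symm hik) hi (Or.inr hik')) (dom l i (Ne.symm hil) hi (Or.inr hil'))).2.1 h
      · exact (key k i l hi (dom k i (Ne.symm hik) hi (Or.inr hik')) (dom l i (Ne.symm hil) hi (Or.inr hil'))).2.1 h
  -- (iii) the perturbed polar Gram matrix and its block sums
  let G' : Matrix (Fin 6) (Fin 6) ℝ := fun a b => ε * (((S' a + S' b).det - (S' a).det - (S' b).det) / 2)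
  have G'_non_left : ∀ a b, rep a ≠ a → G' a b = 0 := fun a b ha => by
    show ε * (((S' a + S' b).det - (S' a).det - (S' b).det) / 2) = 0
    rw [S'_non a ha, polar_zero_left, mul_zero]
  have G'_non_right : ∀ a b, rep b ≠ b → G' a b = 0 := fun a b hb => by
    show ε * (((S' a + S' b).det - (S' a).det - (S' b).det) / 2) = 0
    rw [polar_comm, S'_non b hb, polar_zero_left, mul_zero]
  have G'_rep : ∀ a b, rep a = a → rep b = b →
      G' a b = ε * (((T a + T b).det - (T a).det - (T b).det) / 2) := fun a b ha hb => by
    show ε * (((S' a + S' b).det - (S' a).det - (S' b).det) / 2) = _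
    rw [S'_rep a ha, S'_rep b hb]
  -- `G` summed over a product of classes is `ε · polar` of the class sums
  have hprod : ∀ A B : Finset (Fin 6), ∑ p ∈ A ×ˢ B, G p.1 p.2
      = ε * ((((∑ a ∈ A, S a) + (∑ b ∈ B, S b)).det - (∑ a ∈ A, S a).det - (∑ b ∈ B, S b).det) / 2) := by
    intro A B
    rw [polar_sum_sum, Finset.mul_sum, Finset.sum_product]
    refine Finset.sum_congr rfl fun a _ => ?_
    rw [Finset.mul_sum]
    exact Finset.sum_congr rfl fun b _ => hG a b
  -- regrouping the block sum of `G` at `v` by (class of a, class of b) = the block sum of `G'` at `v`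
  have hBS' : ∀ v : ℝ, (∑ a, ∑ b, if δ' a + δ' b = v then G' a b else 0) = 0 := by
    intro v
    -- LHS: only representative pairs contribute
    have lhs : (∑ a, ∑ b, if δ' a + δ' b = v then G' a b else 0)
        = ∑ a, ∑ b, if (rep a = a ∧ rep b = b) ∧ δ a + δ b = v then G' a b else 0 := by
      refine Finset.sum_congr rfl fun a _ => Finset.sum_congr rfl fun b _ => ?_
      by_cases ha : rep a = a
      · by_cases hb : rep b = b
        · simp only [ha, hb, and_self, true_and, δ'_rep a ha, δ'_rep b hb]
        · simp only [G'_non_right a b hb, ite_self]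
      · simp only [G'_non_left a b ha, ite_self]
    -- RHS of the original block sum, regrouped by representatives
    have fiber : ∀ (f : Fin 6 → Fin 6 → ℝ),
        (∑ a, ∑ b, f a b) = ∑ r, ∑ r', ∑ a ∈ Finset.univ.filter (fun a => rep a = r),
          ∑ b ∈ Finset.univ.filter (fun b => rep b = r'), f a b := by
      intro f
      rw [← Finset.sum_fiberwise Finset.univ rep (fun a => ∑ b, f a b)]
      refine Finset.sum_congr rfl fun r _ => ?_
      rw [Finset.sum_comm]
      conv_lhs => rw [← Finset.sum_fiberwise Finset.univ rep (fun b => ∑ a ∈ Finset.univ.filter (fun a => rep a = r), f a b)]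
      refine Finset.sum_congr rfl fun r' _ => ?_
      rw [Finset.sum_comm]
    -- the fibre of `rep` over `r` is the class of `r` if `r` is a representative, else empty
    have fib_rep : ∀ r, rep r = r → Finset.univ.filter (fun a => rep a = r) = cl r := by
      intro r hr; ext a
      simp only [Finset.mem_filter, Finset.mem_univ, true_and, mem_cl]
      constructor
      · intro h; rw [← h]; exact (rep_val a).symm
      · intro h; rw [rep_eq a r h, hr]
    have fib_non : ∀ r, rep r ≠ r → Finset.univ.filter (fun a => rep a = r) = ∅ := by
      intro r hr
      rw [Finset.filter_eq_empty_iff]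
      intro a _ h
      apply hr
      rw [← h]; exact rep_rep a
    have h0 := hB v
    rw [fiber] at h0
    rw [lhs]
    -- compare term by term in `r, r'`
    have hterm : ∀ r r', (∑ a ∈ Finset.univ.filter (fun a => rep a = r), ∑ b ∈ Finset.univ.filter (fun b => rep b = r'),
        (if δ a + δ b = v then G a b else 0))
        = if (rep r = r ∧ rep r' = r') ∧ δ r + δ r' = v then G' r r' else 0 := by
      intro r r'
      by_cases hr : rep r = r
      · by_cases hr' : rep r' = r'
        · rw [fib_rep r hr, fib_rep r' hr']
          simp only [hr, hr', and_self, true_and]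
          by_cases hv : δ r + δ r' = v
          · rw [if_pos hv, G'_rep r r' hr hr', ← hprod, Finset.sum_product]
            refine Finset.sum_congr rfl fun a ha => Finset.sum_congr rfl fun b hb => ?_
            rw [(mem_cl r a).mp ha, (mem_cl r' b).mp hb, if_pos hv]
          · rw [if_neg hv]
            refine Finset.sum_eq_zero fun a ha => Finset.sum_eq_zero fun b hb => ?_
            rw [(mem_cl r a).mp ha, (mem_cl r' b).mp hb, if_neg hv]
        · rw [fib_non r' hr']
          simp [hr']
      · rw [fib_non r hr]
        simp [hr]
    simp_rw [hterm] at h0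
    exact h0
  -- (iv) realisability of `G'` and the (D) sieve
  have hS'symm : ∀ a, (S' a).IsSymm := fun a => by
    by_cases ha : rep a = a
    · rw [S'_rep a ha]; exact T_symm a
    · rw [S'_non a ha]; exact Matrix.isSymm_zero
  have hG'zero : G' = 0 :=
    pureDSieve δ' hinj hmixed G' hBS' ⟨ε, S', hε, hS'symm, fun a b => rfl⟩
  -- read off the merged Gram entries
  have merged : ∀ a c, ((T a + T c).det - (T a).det - (T c).det) / 2 = 0 := by
    intro a c
    have h := congrFun (congrFun hG'zero (rep a)) (rep c)
    rw [Matrix.zero_apply, G'_rep (rep a) (rep c) (rep_rep a) (rep_rep c), T_eq, T_eq] at h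
    rcases mul_eq_zero.mp h with h' | h'
    · exact absurd h' hε0
    · exact h'
  have hnull : ∀ a, (T a).det = 0 := fun a => by
    have h := merged a a; rwa [polar_self] at h
  refine ⟨hnull, merged, ?_⟩
  intro a c ha
  exact exists_smul_of_polar_eq_zero (T_symm c) (T_symm a) (hnull c) (hnull a) ha (merged c a)

/-- **Corollary (the hypothesis of `Stmt.weylFaces_wall` read literally).**  `¬ HasMixedCoincidence δ` in the line's letter form
(`¬ ∃ i k l` pairwise distinct with `2δᵢ = δₖ + δₗ`) implies the value form used above. [this work] -/
theorem noMixedValue_of_noMixedLetters (δ : Fin 6 → ℝ)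
    (hm : ¬ ∃ i k l : Fin 6, i ≠ k ∧ i ≠ l ∧ k ≠ l ∧ 2 * δ i = δ k + δ l) :
    ∀ i k l : Fin 6, 2 * δ i = δ k + δ l → δ k = δ l := by
  intro i k l h
  by_contra hkl
  have hkl' : k ≠ l := fun e => hkl (by rw [e])
  by_cases hik : i = k
  · subst hik; apply hkl; linarith
  by_cases hil : i = l
  · subst hil; apply hkl; linarith
  exact hm ⟨i, k, l, hik, hil, hkl', h⟩

/-- **Corollary (value-generic points).**  W2's value-genericity implies the value form: `valueAnatomy` is the special case. [this work] -/
theorem noMixedValue_of_valueGeneric (δ : Fin 6 → ℝ)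
    (hV : ∀ a b c e : Fin 6, δ a + δ b = δ c + δ e → (δ a = δ c ∧ δ b = δ e) ∨ (δ a = δ e ∧ δ b = δ c)) :
    ∀ i k l : Fin 6, 2 * δ i = δ k + δ l → δ k = δ l := by
  intro i k l h
  rcases hV i i k l (by linarith) with ⟨h1, h2⟩ | ⟨h1, h2⟩
  · rw [← h1, ← h2]
  · rw [← h1, ← h2]

end Summit.ValiantsHypothesis.ValiantsHypothesis.Theorems.LacunarySymmetroidMatrixDescartes.WallBubbling
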